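import Literature.Geometry.Riemannian.CurvatureDecomposition
import Literature.Geometry.Lorentzian.LeviCivitaCurvature
import Mathlib.LinearAlgebra.CrossProduct
import HarnessLib

/-!
# Hamilton's Lemma A2.1: positive isotropic curvature iff `a₁ + a₂ > 0` and `c₁ + c₂ > 0` (proved)

Companion ("Proofs") file of `Literature/Geometry/Riemannian/CurvatureDecomposition.lean`,
discharging its named fact `Literature.Geometry.Riemannian.hamilton_positiveIsotropicCurvature_iff_blocks`
(**Hamilton 1997, §1.2, Lemma 2.1** = App. A, Lemma A2.1, Comm. Anal. Geom. 5, p. 5: "A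
four-manifold has positive isotropic curvature if and only if `a₁ + a₂ > 0` and `c₁ + c₂ > 0`"),
layer RF3' of the decomposition of `hamilton_chen_tang_zhu` (`HamiltonPICProofs.lean`):
`hamilton_positiveIsotropicCurvature_iff_blocks_holds`. As a consequence the implication
*positive curvature operator ⇒ positive isotropic curvature* of `CurvatureDecomposition.lean`
(`hasPositiveIsotropicCurvature_of_hasPositiveCurvatureOperator`, Micallef–Moore 1988; Hamilton
1997, p. 6) becomes unconditional (`…_holds'` versions at the end).

## The printed proof and its formalisation

Hamilton (p. 5): in a positively oriented orthonormal frame `X₁, …, X₄` the isotropic curvature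
of the plane `Z = X₁ + iX₂`, `W = X₃ + iX₄` is
`K(P) = R₁₃₁₃ + R₁₄₁₄ + R₂₃₂₃ + R₂₄₂₄ - 2R₁₂₃₄ = A₂₂ + A₃₃` by the Bianchi identity
`R₁₂₃₄ + R₁₃₄₂ + R₁₄₂₃ = 0`, "Thus the manifold has positive isotropic curvature if and only if
`a₁ + a₂ > 0`" (the sum of the two smallest eigenvalues of `A` being the minimum of
`A(φ, φ) + A(φ', φ')` over orthonormal pairs of `Λ²₊`, every such pair arising from a frame), and
the same with the opposite orientation for `C`. Frame-wise, over the tree's exterior-algebra-free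
blocks (`blockA`, `blockC`, Ky Fan form `Matrix.TwoSmallestEigenvaluesSumPos`):

1. `isotropicCurvature_eq_blockA_add` — `K(e) = A₂₂ + A₃₃` for every 4-frame `e` (indices from
   `0`: `A 1 1 + A 2 2`), from pair symmetry, skew-adjointness and the first Bianchi identity of
   the curvature of a Levi-Civita connection (`Lorentzian/LeviCivitaCurvature.lean`). This alone
   gives "blocks ⇒ PIC" (`hasPositiveIsotropicCurvatureWith_of_blocks`; only `A` is needed, the
   quantification over all frames absorbing the orientation).
2. "PIC ⇒ `a₁ + a₂ > 0`" (`twoSmallestEigenvaluesSumPos_blockA_of_hasPositiveIsotropicCurvatureWith`):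
   given an orthonormal frame `e` and an orthonormal pair `u, v ∈ ℝ³`, let `w = u × v`; then
   `uᵀAu + vᵀAv + wᵀAw = tr A` (`sum_quadratic_eq_trace_of_orthonormal`). The Givens rotations of
   the frame in the `(e₂, e₃)`- and `(e₁, e₂)`-planes act on Hamilton's basis `φ₁, φ₂, φ₃` of
   `Λ²₊` as the rotations of `ℝ³` about the first and third axes, i.e. conjugate `A`
   (`blockA_frame_rot23`, `blockA_frame_rot12`: `A(e') = ρᵀ A(e) ρ`), and two of them carry `φ₁`
   to `φ_w` (`exists_rotations_apply_eq`); in the rotated frame `e₂`, `tr A(e₂) = tr A(e)` and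
   `A(e₂)₁₁ = wᵀ A(e) w`, so PIC at `e₂` reads `0 < A(e₂)₂₂ + A(e₂)₃₃ = tr A(e) - wᵀA(e)w =
   uᵀA(e)u + vᵀA(e)v`.
3. "PIC ⇒ `c₁ + c₂ > 0`": reversing `e₃` exchanges the roles of `Λ²₊` and `Λ²₋`:
   `A(e₀, e₁, e₂, -e₃) = D C(e) D`, `D = diag(1, 1, -1)` (`blockA_frame_neg3`), and `D` is
   orthogonal.

The hypothesis `g.IsRiemannian` of the named fact is not used: in the frame form the lemma holds
for every `C^∞` pseudo-Riemannian metric on a 4-manifold and every Levi-Civita connection `cov`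
of it (both sides quantify over the `g`-orthonormal 4-frames, of which there may be none).

## References

* R. S. Hamilton, *Four-manifolds with positive isotropic curvature*, Comm. Anal. Geom. 5 (1997)
  1–92, §1.2, pp. 4–6, Lemma 2.1 (p. 5). [Hamilton1997]
* M. J. Micallef, J. D. Moore, Ann. of Math. (2) 127 (1988), 199–227, §1. [MicallefMoore1988]
* B. O'Neill, *Semi-Riemannian geometry*, Academic Press 1983, Ch. 3, Prop. 3.36 (symmetries of
  the curvature). [ONeill1983]
-/

noncomputable section

open Bundle Finset
open scoped Manifold ContDiff Topology BigOperators Matrix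

namespace Literature.Geometry.Riemannian

open Lorentzian Lorentzian.PseudoRiemannianMetric

section Algebra

variable {E : Type*} [NormedAddCommGroup E] [NormedSpace ℝ E] {H : Type*} [TopologicalSpace H]
  {I : ModelWithCorners ℝ E H} {M : Type*} [TopologicalSpace M] [ChartedSpace H M]
  [IsManifold I ∞ M] {n : ℕ∞ω} [FiniteDimensional ℝ E] [CompleteSpace E]
  {g : PseudoRiemannianMetric I n E (TangentSpace I : M → Type _)}
  {cov : CovariantDerivative I E (TangentSpace I : M → Type _)}

/-- **`K(P) = A₂₂ + A₃₃`** (Hamilton 1997, §1.2, p. 5, the display before Lemma 2.1): for every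
4-frame `e` (indices from `0`) the isotropic curvature
`Rm(e₀,e₂,e₂,e₀) + Rm(e₀,e₃,e₃,e₀) + Rm(e₁,e₂,e₂,e₁) + Rm(e₁,e₃,e₃,e₁) - 2 Rm(e₀,e₁,e₃,e₂)` equals
`A 1 1 + A 2 2` for Hamilton's block `A` of the curvature of a Levi-Civita connection `cov` of the
`C^n` metric `g`, `n ≥ 2` — by pair symmetry, skew-adjointness and the first Bianchi identity
`R₁₂₃₄ + R₁₃₄₂ + R₁₄₂₃ = 0` (O'Neill 1983, Prop. 3.36). No orthonormality is needed.
[cite: Hamilton1997, §1.2, p. 5] -/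
theorem isotropicCurvature_eq_blockA_add (h : g.IsLeviCivita cov) (hn : 2 ≤ n) (x : M)
    (e : Fin 4 → TangentSpace I x) :
    g.isotropicCurvature cov x e = g.blockA cov x e 1 1 + g.blockA cov x e 2 2 := by
  have P := h.val_curvature_pair_symm hn x
  have B := h.val_curvature_cyclic hn x
  have A := fun X Y Z W ↦ val_curvature_antisymm (g := g) (cov := cov) x X Y Z W
  have S := h.val_curvature_skew hn x
  rw [blockA_apply_one_one, blockA_apply_two_two]
  simp only [isotropicCurvature, bivectorCurvature, curvatureForm]
  linarith [A (e 3) (e 1) (e 1) (e 3), S (e 1) (e 3) (e 1) (e 3),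
    P (e 3) (e 1) (e 2) (e 0), A (e 2) (e 0) (e 3) (e 1), S (e 0) (e 2) (e 3) (e 1),
    P (e 1) (e 2) (e 3) (e 0), A (e 3) (e 0) (e 1) (e 2), S (e 0) (e 3) (e 1) (e 2),
    B (e 1) (e 2) (e 3) (e 0),
    P (e 2) (e 3) (e 1) (e 0), A (e 1) (e 0) (e 2) (e 3), S (e 0) (e 1) (e 2) (e 3)]

/-! ### Normalisation rules for the curvature components of a frame

Rewriting rules bringing `g(R(eᵢ, eⱼ) e_k, e_l)` to `i < j`, `k < l` (used by `simp` with the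
index conditions discharged by `decide`). -/

omit [FiniteDimensional ℝ E] [CompleteSpace E] in
/-- `g(R(eᵢ,eⱼ)Z, W) = -g(R(eⱼ,eᵢ)Z, W)`, oriented by `j < i` for use as a rewriting rule
(O'Neill 1983, Prop. 3.36 (1)). [cite: ONeill1983, Ch. 3, Prop. 3.36 (1), p. 75] -/
theorem val_curvature_frame_swap12 (x : M) (e : Fin 4 → TangentSpace I x) {i j : Fin 4}
    (_hij : j < i) (Z W : TangentSpace I x) :
    g.val x (cov.curvature x (e i) (e j) Z) W = -g.val x (cov.curvature x (e j) (e i) Z) W :=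
  val_curvature_antisymm x _ _ Z W

/-- `g(R(X,Y)e_k, e_l) = -g(R(X,Y)e_l, e_k)`, oriented by `l < k` for use as a rewriting rule
(O'Neill 1983, Prop. 3.36 (2), for a Levi-Civita connection of a `C^n` metric, `n ≥ 2`).
[cite: ONeill1983, Ch. 3, Prop. 3.36 (2), p. 75] -/
theorem val_curvature_frame_swap34 (h : g.IsLeviCivita cov) (hn : 2 ≤ n) (x : M)
    (e : Fin 4 → TangentSpace I x) {k l : Fin 4} (_hkl : l < k) (X Y : TangentSpace I x) :
    g.val x (cov.curvature x X Y (e k)) (e l) = -g.val x (cov.curvature x X Y (e l)) (e k) :=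
  h.val_curvature_skew hn x X Y _ _

/-- `g(R(X,Y)Z, Z) = 0` (O'Neill 1983, Prop. 3.36 (2)). [cite: ONeill1983, Ch. 3, Prop. 3.36 (2), p. 75] -/
theorem val_curvature_self34 (h : g.IsLeviCivita cov) (hn : 2 ≤ n) (x : M)
    (X Y Z : TangentSpace I x) : g.val x (cov.curvature x X Y Z) Z = 0 := by
  have := h.val_curvature_skew hn x X Y Z Z
  linarith

/-- `g(R(X,Y)e_k, e_k) = 0`, frame form of `val_curvature_self34`. [cite: ONeill1983, Ch. 3, Prop. 3.36 (2), p. 75] -/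
theorem val_curvature_frame_self34 (h : g.IsLeviCivita cov) (hn : 2 ≤ n) (x : M)
    (e : Fin 4 → TangentSpace I x) (k : Fin 4) (X Y : TangentSpace I x) :
    g.val x (cov.curvature x X Y (e k)) (e k) = 0 :=
  val_curvature_self34 h hn x X Y (e k)

omit [FiniteDimensional ℝ E] [CompleteSpace E] in
/-- `g(R(eᵢ,eᵢ)Z, W) = 0` (O'Neill 1983, Prop. 3.36 (1)). [cite: ONeill1983, Ch. 3, Prop. 3.36 (1), p. 75] -/
theorem val_curvature_frame_self12 (x : M) (e : Fin 4 → TangentSpace I x) (i : Fin 4)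
    (Z W : TangentSpace I x) : g.val x (cov.curvature x (e i) (e i) Z) W = 0 := by
  rw [CovariantDerivative.curvature_self, map_zero, _root_.zero_apply]

-- nine entries, each a few hundred curvature monomials: the default heartbeat budget is too small
set_option maxHeartbeats 800000 in
/-- **A rotation of the frame in the `(e₂, e₃)`-plane conjugates Hamilton's block `A` by the
rotation of `Λ²₊ ≅ ℝ³` about the `φ₁`-axis** (indices from `0`): with `e₂' = c e₂ + s e₃`,
`e₃' = -s e₂ + c e₃`, `c² + s² = 1`, one has `φ₀' = φ₀`, `φ₁' = c φ₁ + s φ₂`, `φ₂' = -s φ₁ + c φ₂`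
for the self-dual 2-vectors `φ₀ = e₀∧e₁ + e₂∧e₃`, `φ₁ = e₀∧e₂ + e₃∧e₁`, `φ₂ = e₀∧e₃ + e₁∧e₂`
(Hamilton 1997, p. 5), hence `A(e') = ρᵀ A(e) ρ` with `ρ` the displayed rotation matrix. Proved
entrywise from the multilinearity and the antisymmetries of `g(R(·,·)·,·)` (Levi-Civita `cov` of a
`C^n` metric, `n ≥ 2`); `c² + s² = 1` enters only through `e₂'∧e₃' = e₂∧e₃`.
[cite: Hamilton1997, §1.2, p. 5] -/
theorem blockA_frame_rot23 (h : g.IsLeviCivita cov) (hn : 2 ≤ n) (x : M)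
    (e : Fin 4 → TangentSpace I x) {c s : ℝ} (hcs : c ^ 2 + s ^ 2 = 1) :
    g.blockA cov x ![e 0, e 1, c • e 2 + s • e 3, -s • e 2 + c • e 3] =
      (!![1, 0, 0; 0, c, -s; 0, s, c])ᵀ * g.blockA cov x e * !![1, 0, 0; 0, c, -s; 0, s, c] := by
  -- the rotated pair `(e₂', e₃')` is `(e₂, e₃)` as a 2-vector
  have L1 : ∀ Z W : TangentSpace I x,
      g.val x (cov.curvature x (c • e 2 + s • e 3) (-s • e 2 + c • e 3) Z) W =
        g.val x (cov.curvature x (e 2) (e 3) Z) W := by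
    intro Z W
    have hA := val_curvature_antisymm (g := g) (cov := cov) x (e 3) (e 2) Z W
    simp only [map_add, map_smul, _root_.add_apply, _root_.smul_apply, smul_eq_mul,
      CovariantDerivative.curvature_self, _root_.zero_apply, map_zero]
    linear_combination (g.val x (cov.curvature x (e 2) (e 3) Z) W) * hcs + (- (s * s)) * hA
  have L1' : ∀ X Y : TangentSpace I x,
      g.val x (cov.curvature x X Y (-s • e 2 + c • e 3)) (c • e 2 + s • e 3) =
        g.val x (cov.curvature x X Y (e 3)) (e 2) := by
    intro X Y
    have hS := h.val_curvature_skew hn x X Y (e 2) (e 3)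
    have h2 := val_curvature_self34 h hn x X Y (e 2)
    have h3 := val_curvature_self34 h hn x X Y (e 3)
    simp only [map_add, map_smul, _root_.add_apply, _root_.smul_apply, smul_eq_mul]
    linear_combination (g.val x (cov.curvature x X Y (e 3)) (e 2)) * hcs + (- (s * s)) * hS +
      (-(c * s)) * h2 + (c * s) * h3
  ext i j
  fin_cases i <;> fin_cases j <;>
  · simp only [Fin.zero_eta, Fin.mk_one, Fin.reduceFinMk, Fin.isValue, blockA, pairingCurvature,
      bivectorCurvature, curvatureForm, selfDualPairs, Matrix.of_apply, Fin.sum_univ_two,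
      Fin.sum_univ_three, Matrix.mul_apply, Matrix.transpose_apply, Matrix.cons_val',
      Matrix.cons_val, Matrix.empty_val', Matrix.cons_val_fin_one, L1, L1']
    (try simp only [map_add, map_smul, _root_.add_apply, _root_.smul_apply, smul_eq_mul])
    simp (disch := decide) only [val_curvature_frame_swap12 x e,
      val_curvature_frame_swap34 h hn x e]
    ring

-- nine entries, each a few hundred curvature monomials: the default heartbeat budget is too small
set_option maxHeartbeats 800000 in
/-- **A rotation of the frame in the `(e₁, e₂)`-plane conjugates `A` by the rotation of `Λ²₊`
about the `φ₂`-axis**: with `e₁' = c e₁ + s e₂`, `e₂' = -s e₁ + c e₂`, `c² + s² = 1`, one has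
`φ₀' = c φ₀ + s φ₁`, `φ₁' = -s φ₀ + c φ₁`, `φ₂' = φ₂`, hence `A(e') = ρᵀ A(e) ρ` with `ρ` the
displayed rotation matrix (Hamilton 1997, p. 5, bases of `Λ²₊`). [cite: Hamilton1997, §1.2, p. 5] -/
theorem blockA_frame_rot12 (h : g.IsLeviCivita cov) (hn : 2 ≤ n) (x : M)
    (e : Fin 4 → TangentSpace I x) {c s : ℝ} (hcs : c ^ 2 + s ^ 2 = 1) :
    g.blockA cov x ![e 0, c • e 1 + s • e 2, -s • e 1 + c • e 2, e 3] =
      (!![c, -s, 0; s, c, 0; 0, 0, 1])ᵀ * g.blockA cov x e * !![c, -s, 0; s, c, 0; 0, 0, 1] := by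
  -- the rotated pair `(e₁', e₂')` is `(e₁, e₂)` as a 2-vector
  have L1 : ∀ Z W : TangentSpace I x,
      g.val x (cov.curvature x (c • e 1 + s • e 2) (-s • e 1 + c • e 2) Z) W =
        g.val x (cov.curvature x (e 1) (e 2) Z) W := by
    intro Z W
    have hA := val_curvature_antisymm (g := g) (cov := cov) x (e 2) (e 1) Z W
    simp only [map_add, map_smul, _root_.add_apply, _root_.smul_apply, smul_eq_mul,
      CovariantDerivative.curvature_self, _root_.zero_apply, map_zero]
    linear_combination (g.val x (cov.curvature x (e 1) (e 2) Z) W) * hcs + (- (s * s)) * hA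
  have L1' : ∀ X Y : TangentSpace I x,
      g.val x (cov.curvature x X Y (-s • e 1 + c • e 2)) (c • e 1 + s • e 2) =
        g.val x (cov.curvature x X Y (e 2)) (e 1) := by
    intro X Y
    have hS := h.val_curvature_skew hn x X Y (e 1) (e 2)
    have h2 := val_curvature_self34 h hn x X Y (e 1)
    have h3 := val_curvature_self34 h hn x X Y (e 2)
    simp only [map_add, map_smul, _root_.add_apply, _root_.smul_apply, smul_eq_mul]
    linear_combination (g.val x (cov.curvature x X Y (e 2)) (e 1)) * hcs + (- (s * s)) * hS +
      (-(c * s)) * h2 + (c * s) * h3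
  ext i j
  fin_cases i <;> fin_cases j <;>
  · simp only [Fin.zero_eta, Fin.mk_one, Fin.reduceFinMk, Fin.isValue, blockA, pairingCurvature,
      bivectorCurvature, curvatureForm, selfDualPairs, Matrix.of_apply, Fin.sum_univ_two,
      Fin.sum_univ_three, Matrix.mul_apply, Matrix.transpose_apply, Matrix.cons_val',
      Matrix.cons_val, Matrix.empty_val', Matrix.cons_val_fin_one, L1, L1']
    (try simp only [map_add, map_smul, _root_.add_apply, _root_.smul_apply, smul_eq_mul])
    simp (disch := decide) only [val_curvature_frame_swap12 x e,
      val_curvature_frame_swap34 h hn x e]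
    ring

-- nine entries of curvature monomials: the default heartbeat budget is too small
set_option maxHeartbeats 800000 in
/-- **Reversing the orientation exchanges `A` and `C`**: for the frame `(e₀, e₁, e₂, -e₃)`
Hamilton's self-dual 2-vectors are `φ₀' = ψ₀`, `φ₁' = ψ₁`, `φ₂' = -ψ₂` in terms of the
anti-self-dual `ψᵢ` of `e` (1997, p. 5: `ψ₁ = e₀∧e₁ - e₂∧e₃`, …), hence
`A(e₀, e₁, e₂, -e₃) = D C(e) D` with `D = diag(1, 1, -1)` — the formal content of "for the
opposite orientation `K(P) = C₂₂ + C₃₃`" (Levi-Civita `cov` of a `C^n` metric, `n ≥ 2`).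
[cite: Hamilton1997, §1.2, p. 5] -/
theorem blockA_frame_neg3 (h : g.IsLeviCivita cov) (hn : 2 ≤ n) (x : M)
    (e : Fin 4 → TangentSpace I x) :
    g.blockA cov x ![e 0, e 1, e 2, -e 3] =
      !![1, 0, 0; 0, 1, 0; 0, 0, -1] * g.blockC cov x e * !![1, 0, 0; 0, 1, 0; 0, 0, -1] := by
  ext i j
  fin_cases i <;> fin_cases j <;>
  · simp only [Fin.zero_eta, Fin.mk_one, Fin.reduceFinMk, Fin.isValue, blockA, blockC,
      pairingCurvature, bivectorCurvature, curvatureForm, selfDualPairs, antiSelfDualPairs,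
      Matrix.of_apply, Fin.sum_univ_two, Fin.sum_univ_three, Matrix.mul_apply, Matrix.cons_val',
      Matrix.cons_val, Matrix.empty_val', Matrix.cons_val_fin_one]
    (try simp only [map_neg, _root_.neg_apply])
    simp (disch := decide) only [val_curvature_frame_swap12 x e,
      val_curvature_frame_swap34 h hn x e]
    ring

/-! ### Orthonormality of the modified frames -/

omit [FiniteDimensional ℝ E] [CompleteSpace E] in
/-- Rotating an orthonormal 4-frame in the `(e₂, e₃)`-plane (`c² + s² = 1`) gives an orthonormal
frame. [folklore] -/
theorem _root_.Literature.Geometry.Lorentzian.PseudoRiemannianMetric.IsOrthonormalFrame.frame_rot23 {x : M} {e : Fin 4 → TangentSpace I x}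
    (he : g.IsOrthonormalFrame x e) {c s : ℝ} (hcs : c ^ 2 + s ^ 2 = 1) :
    g.IsOrthonormalFrame x ![e 0, e 1, c • e 2 + s • e 3, -s • e 2 + c • e 3] := by
  obtain ⟨h1, h2⟩ := he
  have h01 := h2 0 1 (by decide); have h02 := h2 0 2 (by decide); have h03 := h2 0 3 (by decide)
  have h10 := h2 1 0 (by decide); have h12 := h2 1 2 (by decide); have h13 := h2 1 3 (by decide)
  have h20 := h2 2 0 (by decide); have h21 := h2 2 1 (by decide); have h23 := h2 2 3 (by decide)
  have h30 := h2 3 0 (by decide); have h31 := h2 3 1 (by decide); have h32 := h2 3 2 (by decide)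
  refine ⟨fun i ↦ ?_, fun i j hij ↦ ?_⟩
  · fin_cases i <;>
    · simp only [Fin.zero_eta, Fin.mk_one, Fin.reduceFinMk, Fin.isValue, Matrix.cons_val,
        map_add, map_smul, _root_.add_apply, _root_.smul_apply, smul_eq_mul, h1 0, h1 1, h1 2,
        h1 3, h23, h32]
      try linear_combination hcs
  · fin_cases i <;> fin_cases j <;>
      first
      | exact absurd rfl hij
      | (simp only [Fin.zero_eta, Fin.mk_one, Fin.reduceFinMk, Fin.isValue, Matrix.cons_val,
          map_add, map_smul, _root_.add_apply, _root_.smul_apply, smul_eq_mul, h1 2, h1 3, h01,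
          h02, h03, h10, h12, h13, h20, h21, h23, h30, h31, h32]
         try ring)

omit [FiniteDimensional ℝ E] [CompleteSpace E] in
/-- Rotating an orthonormal 4-frame in the `(e₁, e₂)`-plane (`c² + s² = 1`) gives an orthonormal
frame. [folklore] -/
theorem _root_.Literature.Geometry.Lorentzian.PseudoRiemannianMetric.IsOrthonormalFrame.frame_rot12 {x : M} {e : Fin 4 → TangentSpace I x}
    (he : g.IsOrthonormalFrame x e) {c s : ℝ} (hcs : c ^ 2 + s ^ 2 = 1) :
    g.IsOrthonormalFrame x ![e 0, c • e 1 + s • e 2, -s • e 1 + c • e 2, e 3] := by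
  obtain ⟨h1, h2⟩ := he
  have h01 := h2 0 1 (by decide); have h02 := h2 0 2 (by decide); have h03 := h2 0 3 (by decide)
  have h10 := h2 1 0 (by decide); have h12 := h2 1 2 (by decide); have h13 := h2 1 3 (by decide)
  have h20 := h2 2 0 (by decide); have h21 := h2 2 1 (by decide); have h23 := h2 2 3 (by decide)
  have h30 := h2 3 0 (by decide); have h31 := h2 3 1 (by decide); have h32 := h2 3 2 (by decide)
  refine ⟨fun i ↦ ?_, fun i j hij ↦ ?_⟩
  · fin_cases i <;>
    · simp only [Fin.zero_eta, Fin.mk_one, Fin.reduceFinMk, Fin.isValue, Matrix.cons_val,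
        map_add, map_smul, _root_.add_apply, _root_.smul_apply, smul_eq_mul, h1 0, h1 1, h1 2,
        h1 3, h12, h21]
      try linear_combination hcs
  · fin_cases i <;> fin_cases j <;>
      first
      | exact absurd rfl hij
      | (simp only [Fin.zero_eta, Fin.mk_one, Fin.reduceFinMk, Fin.isValue, Matrix.cons_val,
          map_add, map_smul, _root_.add_apply, _root_.smul_apply, smul_eq_mul, h1 1, h1 2, h01,
          h02, h03, h10, h12, h13, h20, h21, h23, h30, h31, h32]
         try ring)

omit [FiniteDimensional ℝ E] [CompleteSpace E] in
/-- Reversing the last vector of an orthonormal 4-frame gives an orthonormal frame (the literal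
form of `IsOrthonormalFrame.update_neg` used here). [folklore] -/
theorem _root_.Literature.Geometry.Lorentzian.PseudoRiemannianMetric.IsOrthonormalFrame.frame_neg3 {x : M} {e : Fin 4 → TangentSpace I x}
    (he : g.IsOrthonormalFrame x e) : g.IsOrthonormalFrame x ![e 0, e 1, e 2, -e 3] := by
  obtain ⟨h1, h2⟩ := he
  refine ⟨fun i ↦ ?_, fun i j hij ↦ ?_⟩
  · fin_cases i <;> simp [h1 0, h1 1, h1 2, h1 3, map_neg]
  · fin_cases i <;> fin_cases j <;>
      first
      | exact absurd rfl hij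
      | simp [map_neg, h2 0 1, h2 0 2, h2 0 3, h2 1 0, h2 1 2, h2 1 3, h2 2 0, h2 2 1, h2 2 3,
          h2 3 0, h2 3 1, h2 3 2]

end Algebra

/-! ### Linear algebra on `ℝ³` -/

section LinearAlgebra

/-- **The trace as the sum of the quadratic form over an orthonormal basis**: for any real
`3 × 3` matrix `A` and orthonormal `u, v, w ∈ ℝ³`, `uᵀAu + vᵀAv + wᵀAw = tr A` (the matrix `B`
with rows `u, v, w` has `B Bᵀ = 1`, hence `Bᵀ B = 1`, and `tr (B A Bᵀ) = tr A`). This is the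
step "the minimum of `A(φ,φ) + A(φ',φ')` over orthonormal pairs is `a₁ + a₂ = tr A - a₃`" of
Hamilton's Lemma 2.1 in the Ky Fan form used by `Matrix.TwoSmallestEigenvaluesSumPos`. [folklore] -/
theorem sum_quadratic_eq_trace_of_orthonormal (A : Matrix (Fin 3) (Fin 3) ℝ)
    {u v w : Fin 3 → ℝ} (hu : u ⬝ᵥ u = 1) (hv : v ⬝ᵥ v = 1) (hw : w ⬝ᵥ w = 1) (huv : u ⬝ᵥ v = 0)
    (huw : u ⬝ᵥ w = 0) (hvw : v ⬝ᵥ w = 0) :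
    u ⬝ᵥ (A *ᵥ u) + v ⬝ᵥ (A *ᵥ v) + w ⬝ᵥ (A *ᵥ w) = A.trace := by
  set B : Matrix (Fin 3) (Fin 3) ℝ := Matrix.of ![u, v, w] with hB
  simp only [dotProduct, Fin.sum_univ_three] at hu hv hw huv huw hvw
  have hBBt : B * Bᵀ = 1 := by
    ext i j
    fin_cases i <;> fin_cases j <;>
      simp [B, Matrix.mul_apply, Fin.sum_univ_three] <;> linarith
  have hBtB : Bᵀ * B = 1 := mul_eq_one_comm.1 hBBt
  have key : (B * A * Bᵀ).trace = A.trace := by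
    rw [Matrix.trace_mul_comm, ← Matrix.mul_assoc, hBtB, Matrix.one_mul]
  rw [← key]
  simp only [Matrix.trace_fin_three, Matrix.mul_apply, Matrix.transpose_apply, dotProduct,
    Matrix.mulVec, Fin.sum_univ_three, B, Matrix.of_apply, Matrix.cons_val]
  ring

/-- **Two plane rotations carry the first basis vector to any unit vector**: for `w ∈ ℝ³` with
`|w| = 1` there are `(c, s)` and `(c', s')` on the unit circle with `w = (c, c' s, s' s)`, i.e.
`w = ρ₂₃(c', s') ρ₁₂(c, s) (1, 0, 0)` for the rotations of `blockA_frame_rot23/rot12` — take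
`c = w₀`, `s = √(w₁² + w₂²)`, `(c', s') = (w₁, w₂)/s` (or `(1, 0)` if `s = 0`). [folklore] -/
theorem exists_rotations_apply_eq (w : Fin 3 → ℝ) (hw : w ⬝ᵥ w = 1) :
    ∃ c s c' s' : ℝ, c ^ 2 + s ^ 2 = 1 ∧ c' ^ 2 + s' ^ 2 = 1 ∧
      w 0 = c ∧ w 1 = c' * s ∧ w 2 = s' * s := by
  have hw' : w 0 ^ 2 + w 1 ^ 2 + w 2 ^ 2 = 1 := by
    simpa [dotProduct, Fin.sum_univ_three, sq] using hw
  set r := Real.sqrt (w 1 ^ 2 + w 2 ^ 2) with hr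
  have hr2 : r ^ 2 = w 1 ^ 2 + w 2 ^ 2 := Real.sq_sqrt (by positivity)
  by_cases h0 : r = 0
  · have h12 : w 1 ^ 2 + w 2 ^ 2 = 0 := by rw [← hr2, h0]; ring
    have h1 : w 1 = 0 := by nlinarith [sq_nonneg (w 1), sq_nonneg (w 2)]
    have h2 : w 2 = 0 := by nlinarith [sq_nonneg (w 1), sq_nonneg (w 2)]
    refine ⟨w 0, 0, 1, 0, by nlinarith, by norm_num, rfl, by simp [h1], by simp [h2]⟩
  · refine ⟨w 0, r, w 1 / r, w 2 / r, by nlinarith, ?_, rfl, ?_, ?_⟩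
    · field_simp
      linarith [hr2]
    · field_simp
    · field_simp

/-- The cross product of an orthonormal pair of `ℝ³` is a unit vector (Lagrange's identity,
Mathlib's `cross_dot_cross`). [folklore] -/
theorem dotProduct_cross_self_of_orthonormal {u v : Fin 3 → ℝ} (hu : u ⬝ᵥ u = 1)
    (hv : v ⬝ᵥ v = 1) (huv : u ⬝ᵥ v = 0) : (u ⨯₃ v) ⬝ᵥ (u ⨯₃ v) = 1 := by
  rw [cross_dot_cross, hu, hv, huv, dotProduct_comm v u, huv]
  ring

end LinearAlgebra

/-! ### Hamilton's Lemma A2.1 -/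

section Main

variable {E : Type*} [NormedAddCommGroup E] [NormedSpace ℝ E] {H : Type*} [TopologicalSpace H]
  {I : ModelWithCorners ℝ E H} {M : Type*} [TopologicalSpace M] [ChartedSpace H M]
  [IsManifold I ∞ M] {n : ℕ∞ω} [FiniteDimensional ℝ E] [CompleteSpace E]
  {g : PseudoRiemannianMetric I n E (TangentSpace I : M → Type _)}
  {cov : CovariantDerivative I E (TangentSpace I : M → Type _)}

/-- **PIC implies `a₁ + a₂ > 0`** (Hamilton 1997, §1.2, Lemma 2.1, "only if" for the block
`A`): if `(g, cov)` has positive isotropic curvature (`cov` a Levi-Civita connection of the `C^n`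
metric `g`, `n ≥ 2`), then in every `g`-orthonormal 4-frame `e` the block `A = blockA g cov x e`
satisfies `uᵀAu + vᵀAv > 0` for all orthonormal `u, v ∈ ℝ³`. Proof as in the module docstring:
with `w = u × v`, `uᵀAu + vᵀAv = tr A - wᵀAw`; rotate the frame twice (`blockA_frame_rot23`,
`blockA_frame_rot12`, `exists_rotations_apply_eq`) to a `g`-orthonormal frame `e₂` with
`A(e₂) = Pᵀ A P`, `P Pᵀ = 1`, whose first column is `w`; then `tr A(e₂) = tr A`,
`A(e₂)₀₀ = wᵀAw`, and PIC at `e₂` is `0 < A(e₂)₁₁ + A(e₂)₂₂` by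
`isotropicCurvature_eq_blockA_add`. [cite: Hamilton1997, §1.2, Lemma 2.1 (p. 5)] -/
theorem twoSmallestEigenvaluesSumPos_blockA_of_hasPositiveIsotropicCurvatureWith
    (h : g.IsLeviCivita cov) (hn : 2 ≤ n) (hPIC : g.HasPositiveIsotropicCurvatureWith cov)
    (x : M) {e : Fin 4 → TangentSpace I x} (he : g.IsOrthonormalFrame x e) :
    (g.blockA cov x e).TwoSmallestEigenvaluesSumPos := by
  intro u v hu hv huv
  -- the unit normal of the plane `span(u, v)`
  set w := u ⨯₃ v with hw
  have hww : w ⬝ᵥ w = 1 := dotProduct_cross_self_of_orthonormal hu hv huv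
  have huw : u ⬝ᵥ w = 0 := dot_self_cross u v
  have hvw : v ⬝ᵥ w = 0 := dot_cross_self u v
  have htr : u ⬝ᵥ (g.blockA cov x e *ᵥ u) + v ⬝ᵥ (g.blockA cov x e *ᵥ v) +
      w ⬝ᵥ (g.blockA cov x e *ᵥ w) = (g.blockA cov x e).trace :=
    sum_quadratic_eq_trace_of_orthonormal _ hu hv hww huv huw hvw
  -- two plane rotations bringing `φ₁` to `φ_w`
  obtain ⟨c, s, c', s', hcs, hcs', hw0, hw1, hw2⟩ := exists_rotations_apply_eq w hww
  set e₁ : Fin 4 → TangentSpace I x := ![e 0, e 1, c' • e 2 + s' • e 3, -s' • e 2 + c' • e 3]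
    with he₁def
  set e₂ : Fin 4 → TangentSpace I x := ![e₁ 0, c • e₁ 1 + s • e₁ 2, -s • e₁ 1 + c • e₁ 2, e₁ 3]
    with he₂def
  have he₁ : g.IsOrthonormalFrame x e₁ := he.frame_rot23 hcs'
  have he₂ : g.IsOrthonormalFrame x e₂ := he₁.frame_rot12 hcs
  set ρ₁ : Matrix (Fin 3) (Fin 3) ℝ := !![1, 0, 0; 0, c', -s'; 0, s', c'] with hρ₁
  set ρ₂ : Matrix (Fin 3) (Fin 3) ℝ := !![c, -s, 0; s, c, 0; 0, 0, 1] with hρ₂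
  set P : Matrix (Fin 3) (Fin 3) ℝ := ρ₁ * ρ₂ with hPdef
  have hA₂ : g.blockA cov x e₂ = Pᵀ * g.blockA cov x e * P := by
    rw [he₂def, blockA_frame_rot12 h hn x e₁ hcs, he₁def, blockA_frame_rot23 h hn x e hcs',
      hPdef, Matrix.transpose_mul]
    simp only [Matrix.mul_assoc, hρ₁, hρ₂]
  have hρ₁t : ρ₁ * ρ₁ᵀ = 1 := by
    ext i j
    fin_cases i <;> fin_cases j <;>
      simp [hρ₁, Matrix.mul_apply, Fin.sum_univ_three] <;> nlinarith [hcs']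
  have hρ₂t : ρ₂ * ρ₂ᵀ = 1 := by
    ext i j
    fin_cases i <;> fin_cases j <;>
      simp [hρ₂, Matrix.mul_apply, Fin.sum_univ_three] <;> nlinarith [hcs]
  have hPPt : P * Pᵀ = 1 := by
    rw [hPdef, Matrix.transpose_mul, Matrix.mul_assoc, ← Matrix.mul_assoc ρ₂, hρ₂t,
      Matrix.one_mul, hρ₁t]
  have htr₂ : (g.blockA cov x e₂).trace = (g.blockA cov x e).trace := by
    rw [hA₂, Matrix.trace_mul_comm, ← Matrix.mul_assoc, hPPt, Matrix.one_mul]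
  have hcol : (fun k ↦ P k 0) = w := by
    funext k
    fin_cases k <;>
    · simp only [hPdef, hρ₁, hρ₂, Matrix.mul_apply, Fin.sum_univ_three, Matrix.of_apply,
        Matrix.cons_val', Matrix.cons_val, Matrix.empty_val', Matrix.cons_val_fin_one,
        Fin.zero_eta, Fin.mk_one, Fin.reduceFinMk, Fin.isValue, hw0, hw1, hw2]
      ring
  have h00 : g.blockA cov x e₂ 0 0 = w ⬝ᵥ (g.blockA cov x e *ᵥ w) := by
    rw [hA₂, ← hcol]
    simp only [Matrix.mul_apply, Matrix.transpose_apply, dotProduct, Matrix.mulVec,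
      Fin.sum_univ_three]
    ring
  -- PIC in the frame `e₂`
  have hpos := hPIC x e₂ he₂
  rw [isotropicCurvature_eq_blockA_add h hn x e₂] at hpos
  have htr₂' := Matrix.trace_fin_three (g.blockA cov x e₂)
  linarith

/-- **PIC implies `c₁ + c₂ > 0`** (Hamilton 1997, §1.2, Lemma 2.1, "only if" for the block `C`,
"the same with the opposite orientation"): apply the `A`-statement to the orthonormal frame
`(e₀, e₁, e₂, -e₃)` and the orthonormal pair `Du, Dv`, `D = diag(1, 1, -1)`, using
`A(e₀, e₁, e₂, -e₃) = D C(e) D` (`blockA_frame_neg3`). [cite: Hamilton1997, §1.2, Lemma 2.1 (p. 5)] -/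
theorem twoSmallestEigenvaluesSumPos_blockC_of_hasPositiveIsotropicCurvatureWith
    (h : g.IsLeviCivita cov) (hn : 2 ≤ n) (hPIC : g.HasPositiveIsotropicCurvatureWith cov)
    (x : M) {e : Fin 4 → TangentSpace I x} (he : g.IsOrthonormalFrame x e) :
    (g.blockC cov x e).TwoSmallestEigenvaluesSumPos := by
  intro u v hu hv huv
  set D : Matrix (Fin 3) (Fin 3) ℝ := !![1, 0, 0; 0, 1, 0; 0, 0, -1] with hDdef
  have hD : ∀ y z : Fin 3 → ℝ, (D *ᵥ y) ⬝ᵥ (D *ᵥ z) = y ⬝ᵥ z := fun y z ↦ by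
    simp only [hDdef, dotProduct, Matrix.mulVec, Fin.sum_univ_three, Matrix.of_apply,
      Matrix.cons_val', Matrix.cons_val, Matrix.empty_val', Matrix.cons_val_fin_one]
    ring
  have hA := twoSmallestEigenvaluesSumPos_blockA_of_hasPositiveIsotropicCurvatureWith h hn hPIC x
    he.frame_neg3 (D *ᵥ u) (D *ᵥ v) (by rw [hD, hu]) (by rw [hD, hv]) (by rw [hD, huv])
  rw [blockA_frame_neg3 h hn x e] at hA
  have hq : ∀ y : Fin 3 → ℝ, (D *ᵥ y) ⬝ᵥ ((D * g.blockC cov x e * D) *ᵥ (D *ᵥ y)) =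
      y ⬝ᵥ (g.blockC cov x e *ᵥ y) := fun y ↦ by
    simp only [hDdef, dotProduct, Matrix.mulVec, Matrix.mul_apply, Fin.sum_univ_three,
      Matrix.of_apply, Matrix.cons_val', Matrix.cons_val, Matrix.empty_val', Matrix.cons_val_fin_one]
    ring
  rwa [hq, hq] at hA

/-- **`a₁ + a₂ > 0` in every orthonormal frame implies PIC** (Hamilton 1997, §1.2, Lemma 2.1,
"if"): `K(e) = A₁₁ + A₂₂ = uᵀAu + vᵀAv` for the orthonormal pair `u = (0,1,0)`, `v = (0,0,1)`
(`isotropicCurvature_eq_blockA_add`). Only the block `A` is needed, since the frames of both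
orientations are quantified over. [cite: Hamilton1997, §1.2, Lemma 2.1 (p. 5)] -/
theorem hasPositiveIsotropicCurvatureWith_of_blocks (h : g.IsLeviCivita cov) (hn : 2 ≤ n)
    (hb : ∀ (x : M) (e : Fin 4 → TangentSpace I x), g.IsOrthonormalFrame x e →
      (g.blockA cov x e).TwoSmallestEigenvaluesSumPos) :
    g.HasPositiveIsotropicCurvatureWith cov := by
  intro x e he
  rw [isotropicCurvature_eq_blockA_add h hn x e]
  have := hb x e he (Pi.single 1 1) (Pi.single 2 1) (by simp) (by simp) (by simp)
  simpa [dotProduct, Matrix.mulVec, Fin.sum_univ_three, Pi.single_apply] using this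

end Main

universe u

/-- **Hamilton 1997, §1.2, Lemma 2.1 (= Lemma A2.1), discharged**: the named fact
`hamilton_positiveIsotropicCurvature_iff_blocks` of `CurvatureDecomposition.lean` holds — for a
`C^∞` metric `g` on a smooth 4-manifold and a Levi-Civita connection `cov` of `g`, `(g, cov)`
has positive isotropic curvature iff in every `g`-orthonormal 4-frame both blocks `A` and `C`
satisfy `a₁ + a₂ > 0` (Ky Fan form). "A four-manifold has positive isotropic curvature if and
only if `a₁ + a₂ > 0` and `c₁ + c₂ > 0`" (p. 5). The Riemannian hypothesis of the fact is not
used. [cite: Hamilton1997, §1.2, Lemma 2.1 (p. 5)] -/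
theorem hamilton_positiveIsotropicCurvature_iff_blocks_holds :
    hamilton_positiveIsotropicCurvature_iff_blocks.{u} := by
  intro M _ _ _ g cov _ hcov
  have hn : (2 : ℕ∞ω) ≤ ∞ := WithTop.coe_le_coe.mpr le_top
  refine ⟨fun hPIC x e he ↦ ⟨?_, ?_⟩, fun hb ↦ ?_⟩
  · exact twoSmallestEigenvaluesSumPos_blockA_of_hasPositiveIsotropicCurvatureWith hcov hn hPIC x he
  · exact twoSmallestEigenvaluesSumPos_blockC_of_hasPositiveIsotropicCurvatureWith hcov hn hPIC x he
  · exact hasPositiveIsotropicCurvatureWith_of_blocks hcov hn fun x e he ↦ (hb x e he).1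

/-- **Positive curvature operator implies positive isotropic curvature, unconditionally**
(Micallef–Moore 1988, §1; Hamilton 1997, p. 6): `hasPositiveIsotropicCurvatureWith_of_hasPositiveCurvatureOperatorWith`
of `CurvatureDecomposition.lean` with Hamilton's Lemma 2.1 now supplied by
`hamilton_positiveIsotropicCurvature_iff_blocks_holds`. [cite: Hamilton1997, §1.2, Lemma 2.1 (p. 5) and p. 6] -/
theorem hasPositiveIsotropicCurvatureWith_of_hasPositiveCurvatureOperatorWith'
    (M : Type u) [TopologicalSpace M] [ChartedSpace (EuclideanSpace ℝ (Fin 4)) M]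
    [IsManifold (𝓡 4) ∞ M]
    (g : PseudoRiemannianMetric (𝓡 4) ∞ (EuclideanSpace ℝ (Fin 4)) (TangentSpace (𝓡 4) : M → Type _))
    (cov : CovariantDerivative (𝓡 4) (EuclideanSpace ℝ (Fin 4)) (TangentSpace (𝓡 4) : M → Type _))
    (hg : g.IsRiemannian) (hcov : g.IsLeviCivita cov) (h : g.HasPositiveCurvatureOperatorWith cov) :
    g.HasPositiveIsotropicCurvatureWith cov :=
  hasPositiveIsotropicCurvatureWith_of_hasPositiveCurvatureOperatorWith
    hamilton_positiveIsotropicCurvature_iff_blocks_holds M g cov hg hcov h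

/-- **A Riemannian metric with positive curvature operator on a smooth 4-manifold has positive
isotropic curvature**, unconditionally (Micallef–Moore 1988, §1; Hamilton 1997, p. 6).
[cite: Hamilton1997, §1.2, Lemma 2.1 (p. 5) and p. 6] -/
theorem hasPositiveIsotropicCurvature_of_hasPositiveCurvatureOperator'
    (M : Type u) [TopologicalSpace M] [ChartedSpace (EuclideanSpace ℝ (Fin 4)) M]
    [IsManifold (𝓡 4) ∞ M]
    (g : PseudoRiemannianMetric (𝓡 4) ∞ (EuclideanSpace ℝ (Fin 4)) (TangentSpace (𝓡 4) : M → Type _))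
    (hg : g.IsRiemannian) (h : g.HasPositiveCurvatureOperator) :
    g.HasPositiveIsotropicCurvature :=
  hasPositiveIsotropicCurvature_of_hasPositiveCurvatureOperator
    hamilton_positiveIsotropicCurvature_iff_blocks_holds M g hg h

end Literature.Geometry.Riemannian

end
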